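import Literature.AnabelianGeometry.SemiGraphs.ProSigmaCompletionWreath
import HarnessLib

/-!
# The closed procyclic subgroup of a free basis element is malnormal in the pro-`Σ` completion

[SemiAnbd] Example 2.10 (p. 31) / [AbsAnab] Lemma 1.3.7 (proof): the group-theoretic input of "totally
estranged" for semi-graphs of anabelioids of pointed stable curves is abc-iut-L3-t11's named fact
`ProSigmaCuspInertiaMalnormal` (`SurfaceTypeEstranged.lean`) — in the pro-`Σ` completion of a hyperbolic
punctured surface group the closed cusp inertia subgroups are malnormal and pairwise disjoint up to
conjugacy [cite: MochizukiSemiAnbd2006, Ex. 2.10 p.31].  Clause (A) (infinitude) and the disjointness of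
DISTINCT cusps for `r ≥ 3` were proved by abc-iut-L5-t9 (`ProSigmaCuspInertia.lean`,
`ProSigmaCuspInertiaDisjoint.lean`).

This file proves the MALNORMALITY ENGINE in the generality of a free group `Γ` with a free basis `b`
and a basis element `c = b i`: for a pro-`Σ` completion `ι : Γ → P` (abc-iut-L3-t1's
`IsProSigmaCompletion Sigma ι`, `P` profinite) and `C := closure ι⟨c⟩`,

* `mem_closure_zpowers_of_commute` — if `x ∈ P` commutes with some `y ∈ C`, `y ≠ 1`, then `x ∈ C`;
* `conj_eq_of_mem_closure_zpowers` — if `y ∈ C` and `x y x⁻¹ ∈ C` then `x y x⁻¹ = y`;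
* `closure_zpowers_inf_conj_eq_bot` — **malnormality**: `C ∩ x C x⁻¹ = 1` for every `x ∉ C`.

Route (ours; finite quotients only, no profinite Bass–Serre theory and no `ℤ_Σ`-exponents).  Fix a
finite level `π : P → Q = P/N` with `π x ∉ ⟨π ι c⟩`, `π y = (π ι c)^a ≠ 1`, `m = ord (π ι c)`; as `m ∤ a`
there is a prime power `p^k ∥ m` with `p^k ∤ a` (`p ∈ Σ` since `p ∣ |Q|`).  In the wreath product
`W = C_{p^k} ≀ Q` lift `c` to `ĉ = (δ_1, π ι c)` and the other basis elements into `Q`, extend to a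
continuous `ψ : P → W` (abc-iut-L5-t9's `exists_continuous_extend_top`); then `ψ y = ĉ^n` with
`n ≡ a (mod m)` and `ψ x = (u, π x)` commutes with `ĉ^n`.  Summing the `C_{p^k}`-coordinates of the
commutation identity over the coset `⟨π ι c⟩ ⊆ Q` kills the `u`-terms and the `π x`-translate (because
`π x ∉ ⟨π ι c⟩`) and leaves `n ≡ 0 (mod p^k)` (`natCast_eq_zero_of_commute_wreath_pow`) — contradicting
`p^k ∤ a`.  Theorems only; classical profinite group theory (a special case of the malnormality of free
factors of free pro-`𝒞` products, Herfort–Ribes / Ribes–Zalesskii Thm. 9.1.12); no side is taken on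
[IUTchIII] Cor. 3.12.
-/

namespace Literature.AnabelianGeometry.SemiGraphs.SemiGraphOfAnabelioids.IsProSigmaCompletion

open Literature.AnabelianGeometry.Anabelioids Topology Multiplicative
open scoped Pointwise

variable {Sigma : Set ℕ} {Γ : Type*} [Group Γ] {P : Type*} [Group P] [TopologicalSpace P]
  {ι : Γ →* P}

section Profinite

variable [IsTopologicalGroup P] [CompactSpace P] [TotallyDisconnectedSpace P]

/-- **Centralizers of non-trivial elements of `C = closure ι⟨c⟩`, `c` a free basis element, lie in
`C`.**  Let `Γ` be free with basis `b`, `c = b i`, `ι : Γ → P` a pro-`Σ` completion with `P` profinite,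
`C = closure ι⟨c⟩`.  If `x ∈ P` commutes with some `y ∈ C`, `y ≠ 1`, then `x ∈ C`.
[cite: MochizukiSemiAnbd2006, Ex. 2.10 p.31] -/
theorem mem_closure_zpowers_of_commute {β : Type*} (b : FreeGroupBasis β Γ) (i : β)
    (hι : IsProSigmaCompletion Sigma ι) {x y : P}
    (hy : y ∈ (Subgroup.zpowers (ι (b i))).topologicalClosure) (hy1 : y ≠ 1) (hxy : Commute x y) :
    x ∈ (Subgroup.zpowers (ι (b i))).topologicalClosure := by
  classical
  set c : Γ := b i with hcdef
  set C := (Subgroup.zpowers (ι c)).topologicalClosure with hCdef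
  by_contra hx
  -- an open normal `N₁` with `x N₁ ∩ C = ∅`
  have hCclosed : IsClosed (C : Set P) := Subgroup.isClosed_topologicalClosure _
  have hUo : IsOpen ((fun z => x * z) ⁻¹' (C : Set P)ᶜ) :=
    hCclosed.isOpen_compl.preimage (continuous_const_mul x)
  have hU1 : (1 : P) ∈ (fun z => x * z) ⁻¹' (C : Set P)ᶜ := by
    simpa using hx
  obtain ⟨N₁, hN₁⟩ := ProfiniteGrp.exist_openNormalSubgroup_sub_open_nhds_of_one hUo hU1
  -- an open normal `N₂` missing `y`
  obtain ⟨N₂, hN₂⟩ := ProfiniteGrp.exist_openNormalSubgroup_sub_open_nhds_of_one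
    (isOpen_compl_singleton (x := y)) (show (1 : P) ∈ ({y}ᶜ : Set P) from fun h => hy1 h.symm)
  -- the level `N = N₁ ∩ N₂` and the finite quotient `Q = P / N`
  let N : OpenNormalSubgroup P := N₁ ⊓ N₂
  haveI : (N : Subgroup P).Normal := N.isNormal'
  have hNo : IsOpen ((N : Subgroup P) : Set P) := N.isOpen'
  haveI : Finite (P ⧸ (N : Subgroup P)) := Subgroup.quotient_finite_of_isOpen _ hNo
  letI : Fintype (P ⧸ (N : Subgroup P)) := Fintype.ofFinite _
  haveI : DiscreteTopology (P ⧸ (N : Subgroup P)) := QuotientGroup.discreteTopology hNo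
  let π : P →* P ⧸ (N : Subgroup P) := QuotientGroup.mk' (N : Subgroup P)
  have hπc : Continuous π := QuotientGroup.continuous_mk
  -- `π x ∉ ⟨π ι c⟩`
  have hxbar : π x ∉ Subgroup.zpowers (π (ι c)) := by
    intro hmem
    rw [← MonoidHom.map_zpowers] at hmem
    obtain ⟨z, hz, hzx⟩ := hmem
    have hzC : z ∈ C := Subgroup.le_topologicalClosure _ hz
    have hxz : x⁻¹ * z ∈ (N : Subgroup P) := by
      rw [← QuotientGroup.eq]
      exact hzx.symm
    have := hN₁ (show x⁻¹ * z ∈ (N₁ : Set P) from hxz.1)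
    apply this
    simpa using hzC
  -- `π y ≠ 1`
  have hyN : y ∉ (N : Subgroup P) := fun h => hN₂ (show y ∈ (N₂ : Set P) from h.2) rfl
  have hybar1 : π y ≠ 1 := by
    intro h
    exact hyN ((QuotientGroup.eq_one_iff y).mp h)
  -- `π y = (π ι c)^a`
  have hπy : π y ∈ Subgroup.zpowers (π (ι c)) :=
    map_topologicalClosure_zpowers_le π hπc (ι c) ⟨y, hy, rfl⟩
  obtain ⟨a, ha⟩ : ∃ a : ℕ, π (ι c) ^ a = π y :=
    (Submonoid.mem_powers_iff _ _).mp (mem_powers_iff_mem_zpowers.mpr hπy)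
  -- `m = ord (π ι c)` does not divide `a`; a prime power `p^k ∥ m` with `p^k ∤ a`
  set m : ℕ := orderOf (π (ι c)) with hmdef
  have hm0 : m ≠ 0 := (orderOf_pos _).ne'
  have hma : ¬ m ∣ a := by
    intro hdvd
    apply hybar1
    rw [← ha, ← orderOf_dvd_iff_pow_eq_one]
    exact hdvd
  obtain ⟨p, hp, hk, hpa⟩ := exists_ordProj_not_dvd hm0 hma
  set k : ℕ := m.factorization p with hkdef
  haveI hpf : Fact p.Prime := ⟨hp⟩
  have hpm : p ∣ m := Nat.dvd_of_factorization_pos hk.ne'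
  have hpkm : p ^ k ∣ m := Nat.ordProj_dvd m p
  -- `p ∈ Σ`
  have hQ : IsSigmaInteger Sigma (Nat.card (P ⧸ (N : Subgroup P))) := by
    rw [← Subgroup.index_eq_card]
    exact isSigmaInteger_index hι _ hNo
  have hpS : p ∈ Sigma := hQ.2 p hp (hpm.trans (orderOf_dvd_natCard _))
  have hM : IsSigmaInteger Sigma (p ^ k) := by
    refine ⟨Nat.pow_pos hp.pos, fun q hq hdvd => ?_⟩
    rwa [(Nat.prime_dvd_prime_iff_eq hq hp).mp (hq.dvd_of_dvd_pow hdvd)]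
  haveI : NeZero (p ^ k) := ⟨(Nat.pow_pos hp.pos).ne'⟩
  -- the wreath product `W = C_{p^k} ≀ Q` and the lift of `Γ`
  let W := Multiplicative (ZMod (p ^ k)) ≀ᵣ (P ⧸ (N : Subgroup P))
  letI : TopologicalSpace W := ⊥
  haveI : DiscreteTopology W := ⟨rfl⟩
  have hW : IsSigmaInteger Sigma (Nat.card W) := isSigmaInteger_card_wreath_of hM hQ
  let δ : P ⧸ (N : Subgroup P) → Multiplicative (ZMod (p ^ k)) :=
    fun q => if q = 1 then ofAdd 1 else 1
  let chat : W := ⟨δ, π (ι c)⟩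
  let f : β → W := fun j => if j = i then chat else RegularWreathProduct.inl (π (ι (b j)))
  let φ : Γ →* W := b.lift f
  have hφc : φ c = chat := by
    rw [hcdef, FreeGroupBasis.lift_apply_basis]
    simp [f]
  have hφright : ∀ j, (φ (b j)).right = π (ι (b j)) := by
    intro j
    rw [FreeGroupBasis.lift_apply_basis]
    by_cases hj : j = i
    · subst hj; simp [f, chat, hcdef]
    · simp [f, hj]
  have hright : RegularWreathProduct.rightHom.comp φ = π.comp ι := by
    refine b.ext_hom _ _ fun j => ?_
    simp only [MonoidHom.comp_apply]
    exact hφright j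
  obtain ⟨ψ, hψc, hψ⟩ := hι.exists_continuous_extend_top hW φ
  -- `rightHom ∘ ψ = π` (they agree on the dense image of `Γ`)
  have hψright : ∀ z, (ψ z).right = π z := by
    have h1 : Continuous fun z => (ψ z).right := continuous_of_discreteTopology.comp hψc
    have heq := Continuous.ext_on hι.dense h1 hπc (fun z hz => by
      obtain ⟨γ, rfl⟩ := hz
      show (ψ (ι γ)).right = π (ι γ)
      rw [hψ]
      exact congrArg (fun F : Γ →* _ => F γ) hright)
    exact fun z => congrFun heq z
  -- `ψ y = ĉ^n` with `n ≡ a (mod m)`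
  have hψy : ψ y ∈ Subgroup.zpowers chat := by
    have := map_topologicalClosure_zpowers_le ψ hψc (ι c) ⟨y, hy, rfl⟩
    rwa [hψ, hφc] at this
  obtain ⟨n, hn⟩ : ∃ n : ℕ, chat ^ n = ψ y :=
    (Submonoid.mem_powers_iff _ _).mp (mem_powers_iff_mem_zpowers.mpr hψy)
  have hna : n ≡ a [MOD m] := by
    rw [hmdef, ← pow_eq_pow_iff_modEq, ha]
    have := hψright y
    rw [← hn] at this
    change (chat ^ n).right = π y at this  -- `right` of a power
    rw [← this]
    exact (map_pow RegularWreathProduct.rightHom chat n).symm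
  have hpn : ¬ p ^ k ∣ n := by
    rw [(Nat.ModEq.of_dvd hpkm hna).dvd_iff dvd_rfl]
    exact hpa
  -- `ψ x = (u, π x)` commutes with `ĉ^n`
  have hψx : ψ x = ⟨(ψ x).left, π x⟩ := by
    ext
    · rfl
    · exact hψright x
  have hcomm : Commute (⟨(ψ x).left, π x⟩ : W) (chat ^ n) := by
    rw [← hψx, hn]
    exact hxy.map ψ
  have := natCast_eq_zero_of_commute_wreath_pow (π (ι c)) (π x) hxbar (ψ x).left n hcomm
  exact hpn ((ZMod.natCast_eq_zero_iff n (p ^ k)).mp this)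

/-- **Conjugates inside `C = closure ι⟨c⟩` are trivial conjugates.**  With `c = b i` a free basis
element: if `y ∈ C` and `x y x⁻¹ ∈ C`, then `x y x⁻¹ = y`.  (The coordinate character `c ↦ 1` of
`Γ → ℤ/[P:N₀]`, extended to `P`, kills `y⁻¹ · x y x⁻¹ ∈ C`; an element of `C` killed by it at the level
`N₀ ∩ Ker` lies in `N₀` — for every `N₀`.) [cite: MochizukiSemiAnbd2006, Ex. 2.10 p.31] -/
theorem conj_eq_of_mem_closure_zpowers [T2Space P] {β : Type*} (b : FreeGroupBasis β Γ) (i : β)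
    (hι : IsProSigmaCompletion Sigma ι) {x y : P}
    (hy : y ∈ (Subgroup.zpowers (ι (b i))).topologicalClosure)
    (hxy : x * y * x⁻¹ ∈ (Subgroup.zpowers (ι (b i))).topologicalClosure) :
    x * y * x⁻¹ = y := by
  classical
  set c : Γ := b i with hcdef
  set C := (Subgroup.zpowers (ι c)).topologicalClosure with hCdef
  by_contra hne
  set d : P := y⁻¹ * (x * y * x⁻¹) with hddef
  have hdC : d ∈ C := C.mul_mem (C.inv_mem hy) hxy
  have hd1 : d ≠ 1 := fun h => hne (inv_mul_eq_one.mp h).symm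
  -- an open normal `N₀` missing `d`, of `Σ`-index `n`
  obtain ⟨N₀, hN₀⟩ := ProfiniteGrp.exist_openNormalSubgroup_sub_open_nhds_of_one
    (isOpen_compl_singleton (x := d)) (show (1 : P) ∈ ({d}ᶜ : Set P) from fun h => hd1 h.symm)
  have hdN₀ : d ∉ (N₀ : Subgroup P) := fun h => hN₀ h rfl
  haveI : (N₀ : Subgroup P).Normal := N₀.isNormal'
  obtain ⟨n, hndef⟩ : ∃ n, n = (N₀ : Subgroup P).index := ⟨_, rfl⟩
  have hn : IsSigmaInteger Sigma n := hndef ▸ hι.index_open _ N₀.isNormal' N₀.isOpen'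
  haveI : NeZero n := ⟨hn.1.ne'⟩
  have hcard : IsSigmaInteger Sigma (Nat.card (Multiplicative (ZMod n))) := by
    rw [show Nat.card (Multiplicative (ZMod n)) = n from Nat.card_zmod n]; exact hn
  -- the coordinate character `c ↦ 1`, extended to `P`
  let χ₀ : Γ →* Multiplicative (ZMod n) := b.lift fun j => if j = i then ofAdd 1 else 1
  have hχ₀c : χ₀ c = ofAdd 1 := by
    rw [hcdef, FreeGroupBasis.lift_apply_basis]
    simp
  obtain ⟨χ, hχc, hχ⟩ := hι.exists_continuous_extend_top hcard χ₀
  have e1 : χ d = 1 := by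
    rw [hddef, map_mul, map_inv, map_mul, map_mul, map_inv, mul_inv_cancel_comm, inv_mul_cancel]
  -- the level `K = N₀ ∩ Ker χ`
  have hk₁ : IsOpen (χ.ker : Set P) := (isOpen_discrete ({1} : Set _)).preimage hχc
  let Kχ : OpenNormalSubgroup P := { toSubgroup := χ.ker, isOpen' := hk₁ }
  let K : OpenNormalSubgroup P := N₀ ⊓ Kχ
  have hKle₀ : (K : Subgroup P) ≤ (N₀ : Subgroup P) := fun z hz => hz.1
  have hKleχ : (K : Subgroup P) ≤ χ.ker := fun z hz => hz.2
  haveI : (K : Subgroup P).Normal := K.isNormal'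
  -- `d ∈ ι⟨c⟩ · K`
  have hdC' := topologicalClosure_le_sup_of_isOpen _ (K : Subgroup P) K.isOpen' hdC
  rw [← SetLike.mem_coe, Subgroup.mul_normal] at hdC'
  obtain ⟨t, ht, k₁, hk₁K, hd⟩ := hdC'
  simp only [SetLike.mem_coe] at ht
  obtain ⟨σ, rfl⟩ := Subgroup.mem_zpowers_iff.mp ht
  have e2 : χ d = ofAdd ((σ : ℤ) : ZMod n) := by
    rw [← hd, map_mul, (hKleχ hk₁K : χ k₁ = 1), mul_one, map_zpow, hχ, hχ₀c, ← ofAdd_zsmul, zsmul_one]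
  have hdvd : (n : ℤ) ∣ σ := by
    rw [e1, eq_comm, ofAdd_eq_one, ZMod.intCast_zmod_eq_zero_iff_dvd] at e2
    exact e2
  obtain ⟨e, he⟩ := hdvd
  have hτn : ι c ^ (n : ℤ) ∈ (N₀ : Subgroup P) := by
    rw [zpow_natCast, hndef]
    exact Subgroup.pow_index_mem _ _
  have hτs : ι c ^ σ ∈ (N₀ : Subgroup P) := by
    rw [he, zpow_mul]
    exact Subgroup.zpow_mem _ hτn e
  exact hdN₀ (hd ▸ (N₀ : Subgroup P).mul_mem hτs (hKle₀ hk₁K))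

/-- **Malnormality of `C = closure ι⟨c⟩` for a free basis element `c`.**  Let `Γ` be free with basis
`b`, `c = b i`, `ι : Γ → P` a pro-`Σ` completion (`P` profinite), `C = closure ι⟨c⟩`.  Then
`C ∩ x C x⁻¹ = 1` for every `x ∈ P ∖ C`.  (If `1 ≠ z = x z' x⁻¹` with `z, z' ∈ C`, then
`x z' x⁻¹ = z'` by `conj_eq_of_mem_closure_zpowers`, so `x` commutes with `z' ≠ 1` and lies in `C` by
`mem_closure_zpowers_of_commute`.)  This is the malnormality clause of abc-iut-L3-t11's
`ProSigmaCuspInertiaMalnormal` for a cusp that is a free basis element.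
[cite: MochizukiSemiAnbd2006, Ex. 2.10 p.31] -/
theorem closure_zpowers_inf_conj_eq_bot [T2Space P] {β : Type*} (b : FreeGroupBasis β Γ) (i : β)
    (hι : IsProSigmaCompletion Sigma ι) {x : P}
    (hx : x ∉ (Subgroup.zpowers (ι (b i))).topologicalClosure) :
    (Subgroup.zpowers (ι (b i))).topologicalClosure ⊓
      ConjAct.toConjAct x • (Subgroup.zpowers (ι (b i))).topologicalClosure = ⊥ := by
  rw [eq_bot_iff]
  rintro z ⟨hzC, hzx⟩
  rw [Subgroup.mem_bot]
  by_contra hz1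
  obtain ⟨z', hz', hxz⟩ := (Subgroup.mem_smul_pointwise_iff_exists _ _ _).mp hzx
  rw [ConjAct.toConjAct_smul] at hxz
  have hz'1 : z' ≠ 1 := by
    rintro rfl
    apply hz1
    rw [← hxz, mul_one, mul_inv_cancel]
  have hconj : x * z' * x⁻¹ ∈ (Subgroup.zpowers (ι (b i))).topologicalClosure := by
    rw [hxz]; exact hzC
  have heq := conj_eq_of_mem_closure_zpowers b i hι hz' hconj
  have hcomm : Commute x z' := by
    rw [commute_iff_eq]
    calc x * z' = x * z' * x⁻¹ * x := by group
      _ = z' * x := by rw [heq]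
  exact hx (mem_closure_zpowers_of_commute b i hι hz' hz'1 hcomm)

/-- Malnormality, membership form: if `C ∩ x C x⁻¹ ≠ 1` then `x ∈ C`.
[cite: MochizukiSemiAnbd2006, Ex. 2.10 p.31] -/
theorem mem_closure_zpowers_of_inf_conj_ne_bot [T2Space P] {β : Type*} (b : FreeGroupBasis β Γ)
    (i : β) (hι : IsProSigmaCompletion Sigma ι) {x : P}
    (hx : (Subgroup.zpowers (ι (b i))).topologicalClosure ⊓
      ConjAct.toConjAct x • (Subgroup.zpowers (ι (b i))).topologicalClosure ≠ ⊥) :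
    x ∈ (Subgroup.zpowers (ι (b i))).topologicalClosure := by
  by_contra h
  exact hx (closure_zpowers_inf_conj_eq_bot b i hι h)

end Profinite

end Literature.AnabelianGeometry.SemiGraphs.SemiGraphOfAnabelioids.IsProSigmaCompletion
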